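import Literature.AnabelianGeometry.EtaleTheta.Discharge.Sec5EnvelopeTopology

/-!
# [EtTh] §5, Lemma 5.9 (iv): `E^Π_N ⥲ Π^tp_Y̲[μ_N]` is an isomorphism of mod `N` bi-theta environments — proofs (p. 332 / PDF p. 106)

Mochizuki, *The étale theta function and its Frobenioid-theoretic manifestations*, Publ. RIMS **45**
(2009) [cite: MochizukiEtTh2009, Lem 5.9 (iv) p.106 (PRIMS p.332)].  Layer L2 of the abc-iut cell,
seat abc-iut-L2-t11 (wave-2 unit W2-L2-07).  PROOF-ONLY companion (no new definitions) of
abc-iut-L2-t4's `FrobenioidMonoThetaEnv.lean` (named fact `ThetaFrobenioid.EnvIsoBiTheta`) over the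
dictionary file `Discharge/Sec5EnvelopeTopology.lean`.

Lemma 5.9 (iv): the isomorphism of topological groups `E^Π_N ⥲ Π^tp_Y[μ_N]` "is an isomorphism of
mod `N` bi-theta environments with respect to the model bi-theta environment structure of Definition
2.13, (ii), on `Π^tp_Y[μ_N]` and the mod `N` bi-theta environment structure on `E^Π_N` determined by
the subgroup of `Out(E^Π_N)` generated by the natural outer actions of `l·ℤ` [cf. (iii)], `K^×`
[cf. Lemma 5.8] on `E_N`, together with the `μ_N`-conjugacy classes of subgroups given by the images
of the homomorphisms `s^⊓-Π_N, s^⊔-Π_N : Π^tp_Ÿ̲ → E^Π_N`" (p.106 (PRIMS p.332)).  PROVED here: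
* `map_PiY_eq`, `map_PiYdd_eq` — `ι` carries `Π^tp_Y̲, Π^tp_Ÿ̲` onto `Π^tp_Y, Π^tp_Ÿ`;
* `image_muConjClass` — `μ_N(B_N)`-conjugacy classes go to `μ_N`-conjugacy classes;
* `map_range_sCapPi` — `Im(s^⊓-Π_N) ↦ Im(s^alg_Ÿ)`; `map_range_sCupPi` — `Im(s^⊔-Π_N) ↦ Im(s^Θ_Ÿ)`
  under the Prop. 5.2 (iii) dictionary `ThetaSectionCompat`;
* `envIso_conj_liftPi`, `image_galOut` — the outer `l·ℤ`-action on `E^Π_N` (Lemma 5.9 (iii)) goes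
  ONTO the `Gal(Y/X)`-part of `D_Y`;
* `map_D_eq` — `D ↦ D_Y`, from the previous item and the `K^×`-part hypotheses (Lemma 5.8);
* `envIsoBiTheta_of` — abc-iut-L2-t4's `EnvIsoBiTheta` DISCHARGED MODULO the named hypotheses;
  `frdIsMonoThetaEnv_of'` — hence their `FrdIsMonoThetaEnv` ("In particular … a mod `N` mono-theta
  environment");
* `cycRigidityCoincide_of` — Lemma 5.9 (v) ("the cyclotomic rigidity isomorphism arising from the
  theory of §2 [cf. Corollary 2.19, (i)] coincides with the Frobenioid-theoretic isomorphism of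
  Proposition 5.5", p.106 (PRIMS p.332); abc-iut-L2-t4's `CycRigidityCoincide`) REDUCED to: the §2
  isomorphism transported to `B_N` is read off from the same Kummer class on `H_{B_N}` + the part of
  `H_{B_N}` over `(l·Δ_Θ)_{B_N}` covers `(l·Δ_Θ)_{B_N} ⊗ ℤ/Nℤ`.
HONEST FRAMING: discharges MODULO the hypotheses named in each statement (`Facts`, `IdentifiesPiY`,
`IdentifiesPiYdd`, `CyclotomicCharacterCompatX`, `ThetaSectionCompat`,
`ConstOutTransported`, `KummerOutReached`); [EtTh] is refereed; nothing of it is asserted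
unconditionally; typed ≠ proved; no side is taken on any disputed claim downstream.
-/

namespace Literature.AnabelianGeometry.EtaleTheta

open CategoryTheory
open FrobenioidCyclotomicRigidity

universe w v v' u u'

namespace ThetaFrobenioid

variable {C : Type u} [Category.{v} C] {D : Type u'} [Category.{v'} D]
  (𝔉 : ThetaFrobenioid.{w} C D)

/-! ### The subgroups `Π^tp_Y̲`, `Π^tp_Ÿ̲` are carried onto `Π^tp_Y`, `Π^tp_Ÿ` -/

/-- `ι(Π^tp_Y̲) = Π^tp_Y`. [cite: MochizukiEtTh2009, Lem 5.9 (iv) p.106 (PRIMS p.332)] -/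
theorem map_PiY_eq (T : ThetaEnvData.{v} 𝔉.N) (ι : 𝔉.PiX ≃* T.PiX) (hY : 𝔉.IdentifiesPiY T ι) :
    𝔉.PiY.map ι.toMonoidHom = T.PiY := by
  ext z
  constructor
  · rintro ⟨y, hy, rfl⟩
    exact (hY y).mp hy
  · intro hz
    exact ⟨ι.symm z, (hY _).mpr (by simpa using hz), by simp⟩

/-- `ι(Π^tp_Ÿ̲) = Π^tp_Ÿ`. [cite: MochizukiEtTh2009, Lem 5.9 (iv) p.106 (PRIMS p.332)] -/
theorem map_PiYdd_eq (T : ThetaEnvData.{v} 𝔉.N) (ι : 𝔉.PiX ≃* T.PiX)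
    (hYdd : 𝔉.IdentifiesPiYdd T ι) : 𝔉.PiYdd.map ι.toMonoidHom = T.PiYdd := by
  ext z
  constructor
  · rintro ⟨y, hy, rfl⟩
    exact (hYdd y).mp hy
  · intro hz
    exact ⟨ι.symm z, (hYdd _).mpr (by simpa using hz), by simp⟩

/-! ### Transport of `μ_N`-conjugacy classes and of the sections -/

/-- Transport of a conjugate subgroup along an isomorphism: `E(g K g⁻¹) = E(g) E(K) E(g)⁻¹`.
[cite: MochizukiEtTh2009, Lem 5.9 (iv) p.106 (PRIMS p.332)] -/
private theorem map_conj_map {A B : Type*} [Group A] [Group B] (E : A ≃* B) (K : Subgroup A)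
    (g : A) : (K.map (MulAut.conj g).toMonoidHom).map E.toMonoidHom =
      (K.map E.toMonoidHom).map (MulAut.conj (E g)).toMonoidHom := by
  rw [Subgroup.map_map, Subgroup.map_map]
  congr 1
  ext x
  simp [MulAut.conj_apply, map_mul, map_inv]

section Transport

variable (H : 𝔉.Facts) (T : ThetaEnvData.{v} 𝔉.N) (ι : 𝔉.PiX ≃* T.PiX)
  (m : 𝔉.muTorsion 𝔉.BN 𝔉.N ≃* T.mu) (hY : 𝔉.IdentifiesPiY T ι)
  (hχ : 𝔉.CyclotomicCharacterCompat T ι m)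

/-- The group isomorphism `E^Π_N ⥲ Π^tp_Y[μ_N]` carries the `μ_N(B_N)`-conjugacy class of a subgroup
(abc-iut-L2-t4's `muConjClass`) onto the `μ_N`-conjugacy class of its image (abc-iut-L2-t2's
`CycEnvelope.muConjClass`), because it carries `μ_N(B_N) ↪ E^Π_N` onto `μ_N ↪ Π^tp_Y[μ_N]`.
[cite: MochizukiEtTh2009, Lem 5.9 (iv) p.106 (PRIMS p.332)] -/
theorem image_muConjClass (K : Subgroup 𝔉.EPiN) :
    (fun L : Subgroup 𝔉.EPiN => L.map (𝔉.envIso H T ι m hY hχ).toMonoidHom) '' 𝔉.muConjClass K =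
      CycEnvelope.muConjClass T.augY T.chi (K.map (𝔉.envIso H T ι m hY hχ).toMonoidHom) := by
  have hmu : ∀ u, 𝔉.envIso H T ι m hY hχ (𝔉.muIncl u) = CycEnvelope.inMu T.augY T.chi (m u) :=
    𝔉.envIso_muIncl H T ι m hY hχ
  ext L
  constructor
  · rintro ⟨L0, ⟨u, rfl⟩, rfl⟩
    refine ⟨m u, ?_⟩
    change (K.map _).map _ = _
    rw [map_conj_map, hmu]
  · rintro ⟨a, rfl⟩
    refine ⟨K.map (MulAut.conj (𝔉.muIncl (m.symm a))).toMonoidHom, ⟨m.symm a, rfl⟩, ?_⟩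
    change (K.map _).map _ = _
    rw [map_conj_map, hmu, MulEquiv.apply_symm_apply]

/-- **`[Im s^⊓-Π_N] ↦ [Im s^alg_Ÿ]`**: the image of `Im(s^⊓-Π_N)` is `Im(s^alg_Ÿ)` (from
abc-iut-L2-t4's `envIso_sCapPi` and the identification of `Π^tp_Ÿ̲` with `Π^tp_Ÿ`).
[cite: MochizukiEtTh2009, Lem 5.9 (iv) p.106 (PRIMS p.332)] -/
theorem map_range_sCapPi (hYdd : 𝔉.IdentifiesPiYdd T ι) (hsec : 𝔉.SgpCapSection) :
    (𝔉.sCapPi hsec).range.map (𝔉.envIso H T ι m hY hχ).toMonoidHom = T.sAlg.range := by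
  have hs : 𝔉.sCapPi hsec = 𝔉.sCapPi H.sgpCapSection := rfl
  ext z
  constructor
  · rintro ⟨_, ⟨h, rfl⟩, rfl⟩
    refine ⟨⟨ι h, (hYdd _).mp h.2⟩, ?_⟩
    change T.sAlg _ = 𝔉.envIso H T ι m hY hχ (𝔉.sCapPi hsec h)
    rw [hs, 𝔉.envIso_sCapPi H T ι m hY hχ h]
    rfl
  · rintro ⟨h', rfl⟩
    have hh : ι.symm (h' : T.PiX) ∈ 𝔉.PiYdd := (hYdd _).mpr (by simp)
    refine ⟨𝔉.sCapPi hsec ⟨_, hh⟩, ⟨⟨_, hh⟩, rfl⟩, ?_⟩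
    change 𝔉.envIso H T ι m hY hχ (𝔉.sCapPi hsec ⟨_, hh⟩) = T.sAlg h'
    rw [hs, 𝔉.envIso_sCapPi]
    change CycEnvelope.algSection T.augY T.chi _ = CycEnvelope.algSection T.augY T.chi (T.inclYdd h')
    congr 1
    exact Subtype.ext (by simp)

/-- **`[Im s^⊔-Π_N] ↦ [Im s^Θ_Ÿ]`**: under the Prop. 5.2 (iii) dictionary `ThetaSectionCompat` for a
cocycle `η` of the collection, the image of `Im(s^⊔-Π_N)` is `Im(s^Θ_Ÿ)` for the theta section built
from `η`.  [cite: MochizukiEtTh2009, Lem 5.9 (iv) p.106 (PRIMS p.332)] -/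
theorem map_range_sCupPi (hYdd : 𝔉.IdentifiesPiYdd T ι) (h1 : 𝔉.SectionsFactor)
    (hcs : 𝔉.SgpCupSection) {η : T.PiYdd → T.mu} (hη : η ∈ T.thetaCocycles)
    (hcompat : 𝔉.ThetaSectionCompat H T ι m hYdd η) :
    (𝔉.sCupPi h1 hcs).range.map (𝔉.envIso H T ι m hY hχ).toMonoidHom = (T.sTheta hη).range := by
  ext z
  constructor
  · rintro ⟨_, ⟨h, rfl⟩, rfl⟩
    refine ⟨⟨ι h, (hYdd _).mp h.2⟩, ?_⟩
    change T.sTheta hη _ = 𝔉.envIso H T ι m hY hχ (𝔉.sCupPi h1 hcs h)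
    ext
    · change (η ⟨ι (h : 𝔉.PiX), (hYdd _).mp h.2⟩)⁻¹ = m (𝔉.unitPart H (𝔉.sCupPi h1 hcs h))
      rw [unitPart_sCupPi, hcompat h]
    · rfl
  · rintro ⟨h', rfl⟩
    have hh : ι.symm (h' : T.PiX) ∈ 𝔉.PiYdd := (hYdd _).mpr (by simp)
    refine ⟨𝔉.sCupPi h1 hcs ⟨_, hh⟩, ⟨⟨_, hh⟩, rfl⟩, ?_⟩
    change 𝔉.envIso H T ι m hY hχ (𝔉.sCupPi h1 hcs ⟨_, hh⟩) = T.sTheta hη h'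
    ext
    · change m (𝔉.unitPart H (𝔉.sCupPi h1 hcs ⟨_, hh⟩)) = (η h')⁻¹
      rw [unitPart_sCupPi, hcompat]
      congr 2
      exact Subtype.ext (by simp)
    · change ι (ι.symm (h' : T.PiX)) = ((T.inclYdd h' : T.PiY) : T.PiX)
      simp

/-- **The `l·ℤ`-part of `D` is carried to the `Gal(Y/X)`-part of `D_Y`**, elementwise: conjugation
by `(s^⊓-gp_N(ρ g), g)` on `E^Π_N` (Lemma 5.9 (iii)) corresponds under `E^Π_N ⥲ Π^tp_Y[μ_N]` to
abc-iut-L2-t2's `conjX (ι g)` (conjugation on `Π^tp_Y`, cyclotomic character on `μ_N`), given the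
cyclotomic-character dictionary on all of `Π^tp_X̲`.
[cite: MochizukiEtTh2009, Lem 5.9 (iv) p.106 (PRIMS p.332)] -/
theorem envIso_conj_liftPi (hχX : 𝔉.CyclotomicCharacterCompatX T ι m) (h3 : 𝔉.OuterActionLZ)
    (hsec : 𝔉.SgpCapSection) (g : 𝔉.PiX) (x : 𝔉.EPiN) :
    𝔉.envIso H T ι m hY hχ
        (𝔉.EPiN.normalizerMonoidHom ⟨𝔉.liftPi g, 𝔉.liftPi_mem_normalizer h3 hsec g⟩ x) =
      T.conjX (ι g) (𝔉.envIso H T ι m hY hχ x) := by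
  have hval : ((𝔉.EPiN.normalizerMonoidHom ⟨𝔉.liftPi g, 𝔉.liftPi_mem_normalizer h3 hsec g⟩ x :
      𝔉.EPiN) : Aut 𝔉.BN × 𝔉.PiX) = 𝔉.liftPi g * (x : Aut 𝔉.BN × 𝔉.PiX) * (𝔉.liftPi g)⁻¹ := rfl
  have h1 : (𝔉.liftPi g * (x : Aut 𝔉.BN × 𝔉.PiX) * (𝔉.liftPi g)⁻¹).1 =
      𝔉.sgpCap (𝔉.ρ g) * x.1.1 * (𝔉.sgpCap (𝔉.ρ g))⁻¹ := rfl
  have h2 : (𝔉.liftPi g * (x : Aut 𝔉.BN × 𝔉.PiX) * (𝔉.liftPi g)⁻¹).2 = g * x.1.2 * g⁻¹ := rfl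
  have hu : ((𝔉.unitPart H (𝔉.EPiN.normalizerMonoidHom
        ⟨𝔉.liftPi g, 𝔉.liftPi_mem_normalizer h3 hsec g⟩ x) : 𝔉.muTorsion 𝔉.BN 𝔉.N) : Aut 𝔉.BN) =
      𝔉.sgpCap (𝔉.ρ g) * (𝔉.unitPart H x : Aut 𝔉.BN) * (𝔉.sgpCap (𝔉.ρ g))⁻¹ := by
    rw [coe_unitPart, coe_unitPart, hval, h1, h2]
    simp only [map_mul, map_inv, mul_inv_rev, inv_inv]
    group
  ext
  · change m (𝔉.unitPart H _) = T.chi (T.aug (ι g)) (m (𝔉.unitPart H x))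
    exact hχX g (𝔉.unitPart H x) _ hu
  · change ι ((𝔉.EPiN.normalizerMonoidHom ⟨𝔉.liftPi g, 𝔉.liftPi_mem_normalizer h3 hsec g⟩ x :
      𝔉.EPiN) : Aut 𝔉.BN × 𝔉.PiX).2 = ι g * ι x.1.2 * (ι g)⁻¹
    rw [hval, h2, map_mul, map_mul, map_inv]

end Transport

/-! ### The isomorphism of bi-theta environments -/

section Assembly

variable (H : 𝔉.Facts) (h1 : 𝔉.SectionsFactor) (h3 : 𝔉.OuterActionLZ) (hsec : 𝔉.SgpCapSection)
  (hcs : 𝔉.SgpCupSection) (h8 : 𝔉.ConstantsEqNormalizer) (DK : Set (TopOut 𝔉.EPiN))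
  (T : ThetaEnvData.{v} 𝔉.N) (ι : 𝔉.PiX ≃ₜ* T.PiX) (m : 𝔉.muTorsion 𝔉.BN 𝔉.N ≃* T.mu)
  (hY : 𝔉.IdentifiesPiY T ι.toMulEquiv) (hYdd : 𝔉.IdentifiesPiYdd T ι.toMulEquiv)
  (hχX : 𝔉.CyclotomicCharacterCompatX T ι.toMulEquiv m)

/-- **The `l·ℤ`-part of `D ↦ D_Y`**: transport along `E^Π_N ≃ₜ* Π^tp_Y[μ_N]` carries the outer
`Π^tp_X̲`-action on `E^Π_N` (abc-iut-L2-t4's `galOut`, Lemma 5.9 (iii)) ONTO the `Gal(Y/X)`-part of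
`D_Y` (abc-iut-L2-t2's `ThetaEnvData.galOut`).  Arguments: `H h3 hsec T ι m hY hχX`.
[cite: MochizukiEtTh2009, Lem 5.9 (iv) p.106 (PRIMS p.332)] -/
theorem image_galOut :
    TopOut.transport (𝔉.envContIso H T ι m hY hχX.toY) '' 𝔉.galOut h3 hsec = T.galOut := by
  have key : ∀ g : 𝔉.PiX, MulAut.congr (𝔉.envContIso H T ι m hY hχX.toY).toMulEquiv
      (𝔉.EPiN.normalizerMonoidHom ⟨𝔉.liftPi g, 𝔉.liftPi_mem_normalizer h3 hsec g⟩) =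
        T.conjX (ι g) := by
    intro g
    apply MulEquiv.ext
    intro z
    obtain ⟨x, rfl⟩ := (𝔉.envContIso H T ι m hY hχX.toY).surjective z
    change (𝔉.envContIso H T ι m hY hχX.toY)
        (𝔉.EPiN.normalizerMonoidHom ⟨𝔉.liftPi g, 𝔉.liftPi_mem_normalizer h3 hsec g⟩
          ((𝔉.envContIso H T ι m hY hχX.toY).symm (𝔉.envContIso H T ι m hY hχX.toY x))) = _
    rw [ContinuousMulEquiv.symm_apply_apply]
    exact 𝔉.envIso_conj_liftPi H T ι.toMulEquiv m hY hχX.toY hχX h3 hsec g x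
  ext o
  constructor
  · rintro ⟨_, ⟨g, rfl⟩, rfl⟩
    have hc : T.conjX (ι g) ∈ contMulAut T.env := by
      rw [← key g]
      exact conjAut_mem_contMulAut _ (𝔉.normalizerMonoidHom_mem_contMulAut _)
    refine ⟨ι g, hc, ?_⟩
    change TopOut.mk _ (conjContAut _ _) = TopOut.mk _ ⟨T.conjX (ι g), hc⟩
    congr 1
    exact Subtype.ext (key g)
  · rintro ⟨g', hc, rfl⟩
    refine ⟨𝔉.conjOut ⟨𝔉.liftPi (ι.symm g'), 𝔉.liftPi_mem_normalizer h3 hsec _⟩,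
      ⟨ι.symm g', rfl⟩, ?_⟩
    change TopOut.mk _ (conjContAut _ _) = TopOut.mk _ ⟨T.conjX g', hc⟩
    congr 1
    apply Subtype.ext
    have hk := key (ι.symm g')
    rw [ContinuousMulEquiv.apply_symm_apply] at hk
    exact hk

/-- **`D ↦ D_Y`** assembled from the `l·ℤ`-part (PROVED, `image_galOut`) and the `K^×`-part (named
hypotheses `ConstOutTransported`, `KummerOutReached` of `Discharge/Sec5EnvelopeTopology.lean`).
Arguments: `H h1 h3 hsec hcs h8 DK T ι m hY hχX hK1 hK2`.
[cite: MochizukiEtTh2009, Lem 5.9 (iv) p.106 (PRIMS p.332)] -/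
theorem map_D_eq (hK1 : 𝔉.ConstOutTransported H h8 DK T ι m hY hχX.toY)
    (hK2 : 𝔉.KummerOutReached H h1 h3 hsec hcs h8 DK T ι m hY hχX.toY) :
    (𝔉.frdBiThetaEnv h1 h3 hsec hcs h8 DK).D.map
        (TopOut.transport (𝔉.envContIso H T ι m hY hχX.toY)) = T.DY := by
  have hgal := 𝔉.image_galOut H h3 hsec T ι m hY hχX
  apply le_antisymm
  · change (Subgroup.closure (𝔉.galOut h3 hsec ∪ 𝔉.constOut h8 ∪ DK)).map _ ≤ T.DY
    rw [MonoidHom.map_closure, Subgroup.closure_le, Set.union_assoc, Set.image_union, hgal]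
    refine Set.union_subset ?_ hK1
    exact fun o ho => Subgroup.subset_closure (Or.inr ho)
  · change Subgroup.closure (T.kummerOut ∪ T.galOut) ≤ _
    rw [Subgroup.closure_le]
    refine Set.union_subset hK2 ?_
    rw [← hgal]
    rintro _ ⟨a, ha, rfl⟩
    exact Subgroup.mem_map_of_mem _
      (Subgroup.subset_closure (Or.inl (Or.inl ha)) : a ∈ (𝔉.frdBiThetaEnv h1 h3 hsec hcs h8 DK).D)

/-- **`[Im s^⊔-Π_N] ↦ [Im s^Θ_Ÿ]` at the level of `μ_N`-conjugacy classes** (the `s^Θ`-clause of the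
isomorphism of bi-theta environments), under the Prop. 5.2 (iii) dictionary for `η`.
[cite: MochizukiEtTh2009, Lem 5.9 (iv) p.106 (PRIMS p.332)] -/
theorem map_sTheta_eq {η : T.PiYdd → T.mu} (hη : η ∈ T.thetaCocycles)
    (hcompat : 𝔉.ThetaSectionCompat H T ι.toMulEquiv m hYdd η) :
    (fun L : Subgroup 𝔉.EPiN =>
        L.map (𝔉.envContIso H T ι m hY hχX.toY).toMulEquiv.toMonoidHom) ''
      (𝔉.frdBiThetaEnv h1 h3 hsec hcs h8 DK).sTheta =
        CycEnvelope.muConjClass T.augY T.chi (T.sTheta hη).range := by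
  change (fun L : Subgroup 𝔉.EPiN =>
      L.map (𝔉.envIso H T ι.toMulEquiv m hY hχX.toY).toMonoidHom) ''
        𝔉.muConjClass (𝔉.sCupPi h1 hcs).range = _
  rw [𝔉.image_muConjClass, 𝔉.map_range_sCupPi H T ι.toMulEquiv m hY hχX.toY hYdd h1 hcs hη hcompat]

include hYdd in
/-- **`[Im s^⊓-Π_N] ↦ [Im s^alg_Ÿ]` at the level of `μ_N`-conjugacy classes** (the `s^alg`-clause).
[cite: MochizukiEtTh2009, Lem 5.9 (iv) p.106 (PRIMS p.332)] -/
theorem map_sAlg_eq :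
    (fun L : Subgroup 𝔉.EPiN =>
        L.map (𝔉.envContIso H T ι m hY hχX.toY).toMulEquiv.toMonoidHom) ''
      (𝔉.frdBiThetaEnv h1 h3 hsec hcs h8 DK).sAlg =
        CycEnvelope.muConjClass T.augY T.chi T.sAlg.range := by
  change (fun L : Subgroup 𝔉.EPiN =>
      L.map (𝔉.envIso H T ι.toMulEquiv m hY hχX.toY).toMonoidHom) ''
        𝔉.muConjClass (𝔉.sCapPi hsec).range = _
  rw [𝔉.image_muConjClass, 𝔉.map_range_sCapPi H T ι.toMulEquiv m hY hχX.toY hYdd hsec]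

/-- **[EtTh] Lemma 5.9 (iv) DISCHARGED MODULO the named hypotheses**: abc-iut-L2-t4's named fact
`EnvIsoBiTheta` — "the natural inclusions `μ_N(B_N) ↪ E_N`, `Im(Π^tp_Y) ⊆ E_N` determine an
isomorphism of topological groups `E^Π_N ⥲ Π^tp_Y[μ_N]` which is an isomorphism of mod `N` bi-theta
environments" (p.106 (PRIMS p.332)) — holds given: the printed-facts bundle `Facts` (pp.104–105),
the interface identifications `ι` (continuous, carrying `Π^tp_Y̲, Π^tp_Ÿ̲` to `Π^tp_Y, Π^tp_Ÿ`) and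
`m`, the cyclotomic-character dictionary on `Π^tp_X̲`, the Prop. 5.2 (iii)
dictionary for a cocycle `η` of the collection, and the `K^×`-part of `D ↦ D_Y` (Lemma 5.8).  The
isomorphism is `envContIso`; `map_sAlg`, `map_sTheta` and the `l·ℤ`-part of `map_D` are proved.
[cite: MochizukiEtTh2009, Lem 5.9 (iv) p.106 (PRIMS p.332)] -/
theorem envIsoBiTheta_of {η : T.PiYdd → T.mu} (hη : η ∈ T.thetaCocycles)
    (hcompat : 𝔉.ThetaSectionCompat H T ι.toMulEquiv m hYdd η)
    (hK1 : 𝔉.ConstOutTransported H h8 DK T ι m hY hχX.toY)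
    (hK2 : 𝔉.KummerOutReached H h1 h3 hsec hcs h8 DK T ι m hY hχX.toY) :
    𝔉.EnvIsoBiTheta h1 h3 hsec hcs h8 DK T ι :=
  ⟨𝔉.map_PiY_eq T ι.toMulEquiv hY, 𝔉.map_PiYdd_eq T ι.toMulEquiv hYdd, η, hη,
    { e := 𝔉.envContIso H T ι m hY hχX.toY
      map_D := 𝔉.map_D_eq H h1 h3 hsec hcs h8 DK T ι m hY hχX hK1 hK2
      map_sTheta := 𝔉.map_sTheta_eq H h1 h3 hsec hcs h8 DK T ι m hY hYdd hχX hη hcompat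
      map_sAlg := 𝔉.map_sAlg_eq H h1 h3 hsec hcs h8 DK T ι m hY hYdd hχX },
    fun _ => rfl,
    fun u => ⟨m u, (𝔉.envIso_muIncl H T ι.toMulEquiv m hY hχX.toY u).symm⟩⟩

/-- **Lemma 5.9 (iv) "In particular" DISCHARGED MODULO the same hypotheses**: the Frobenioid-theoretic
data `frdMonoThetaEnv` IS a mod `N` mono-theta environment (abc-iut-L2-t4's `FrdIsMonoThetaEnv`, via
their `frdIsMonoThetaEnv_of`).  [cite: MochizukiEtTh2009, Lem 5.9 (iv) p.106 (PRIMS p.332)] -/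
theorem frdIsMonoThetaEnv_of' {η : T.PiYdd → T.mu} (hη : η ∈ T.thetaCocycles)
    (hcompat : 𝔉.ThetaSectionCompat H T ι.toMulEquiv m hYdd η)
    (hK1 : 𝔉.ConstOutTransported H h8 DK T ι m hY hχX.toY)
    (hK2 : 𝔉.KummerOutReached H h1 h3 hsec hcs h8 DK T ι m hY hχX.toY) :
    𝔉.FrdIsMonoThetaEnv h1 h3 hsec hcs h8 DK T :=
  𝔉.frdIsMonoThetaEnv_of h1 h3 hsec hcs h8 DK T ι
    (𝔉.envIsoBiTheta_of H h1 h3 hsec hcs h8 DK T ι m hY hYdd hχX hη hcompat hK1 hK2)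

end Assembly

/-! ### Lemma 5.9 (v) -/

section Coincide

/-- **[EtTh] Lemma 5.9 (v) REDUCED**: "In the situation of (iv), the cyclotomic rigidity isomorphism
arising from the theory of §2 [cf. Corollary 2.19, (i)] coincides with the Frobenioid-theoretic
isomorphism of Proposition 5.5 [where we take '`S`' to be `B_N`]" (p.106 (PRIMS p.332)) — abc-iut-L2-t4's
`CycRigidityCoincide ρ219 ρ hB` — holds as soon as the §2 isomorphism transported to `B_N` (`ρ219`,
their parameter; abc-iut-L2-t2's Cor. 2.19 (i)) is read off from the same Kummer class on the part of
`H_{B_N}` over `(l·Δ_Θ)_{B_N}` (`h219`, in print's orientation `s^⊓-gp_N · (s^⊔-gp_N)⁻¹` of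
Prop. 4.3 (iii), matching abc-iut-L2-t4's `IsKummerDetermined` v3: via the isomorphism of (iv) the two
theta sections differ by the class `η̲̈^Θ`, from which BOTH isomorphisms are constructed) and that part
covers `(l·Δ_Θ)_{B_N} ⊗ ℤ/Nℤ`.  [cite: MochizukiEtTh2009, Lem 5.9 (v) p.106 (PRIMS p.332)] -/
theorem cycRigidityCoincide_of (P : ThetaSubquotientProj 𝔉) (hB : 𝔉.IsThetaSaturated 𝔉.BN)
    (hcov : ∀ x : 𝔉.lDeltaModN 𝔉.BN, ∃ (h : 𝔉.HB)
      (hh : (h : Aut (𝔉.base.obj 𝔉.BN)) ∈ P.pre (𝔉.base.obj 𝔉.BN)),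
      (QuotientGroup.mk (P.proj _ ⟨h, hh⟩) : 𝔉.lDeltaModN 𝔉.BN) = x)
    (ρ219 : 𝔉.lDeltaModN 𝔉.BN ≃* 𝔉.muTorsion 𝔉.BN 𝔉.N) (ρ : RigidityFamily 𝔉)
    (hρ : IsKummerDetermined 𝔉 P ρ hB)
    (h219 : ∀ (h : 𝔉.HB) (hh : (h : Aut (𝔉.base.obj 𝔉.BN)) ∈ P.pre (𝔉.base.obj 𝔉.BN)),
      (ρ219 (QuotientGroup.mk (P.proj _ ⟨h, hh⟩)) : Aut 𝔉.BN) =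
        𝔉.sgpCap (h : Aut (𝔉.base.obj 𝔉.BN)) * (𝔉.sgpCup h)⁻¹) :
    𝔉.CycRigidityCoincide ρ219 ρ hB := by
  apply MulEquiv.ext
  intro x
  obtain ⟨h, hh, rfl⟩ := hcov x
  apply Subtype.ext
  rw [hρ h hh, h219 h hh]

end Coincide

end ThetaFrobenioid

end Literature.AnabelianGeometry.EtaleTheta
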